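import Literature.NumberTheory.EllipticCurves.BurungaleKobayashiNakamuraOta2026.LocalBottomIndex
import Literature.NumberTheory.EllipticCurves.KolyvaginShaStructureIndexFormProofs
import HarnessLib

/-!
# `E(K̄)^H` is a finitely generated abelian group when `K̄^H / K` is finite; infinitely `p`-divisible
# fixed points are torsion (Galois descent at an intermediate field + the Mordell–Weil theorem; proofs file)

Topic `NumberTheory/EllipticCurves`. THEOREMS ONLY (no definition, no named fact, no `sorry`, no instance).
Written by the cell `bsd-print-x9`, seat `bsd-line-x9-p1-w2` (g14), as brick F1 of the deduction
«Cornut–Vatsal 2007 Thm. 1.10 ⇒ the `Λ`-adic stabilised Heegner class `κ_∞` of the coherent CGLS datum is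
non-zero» (write-crux stmt-BirchSwinnertonDyer-25235; files `HeegnerStabilizedClassNonvanishingProofs`, …):
that argument shows that a certain `K_k`-rational point is divisible by every power of `p` inside `E(K_k)`
and needs to conclude that it is torsion, i.e. it needs the Mordell–Weil theorem AT THE LAYER `K_k`, in the
tree's currency `fixedGeomPoints (W.baseChange K) (κ.layerSubgroup k) ≤ E(K̄)`. The tree had this only at
the bottom layer (`moduleFinite_fixedGeomPoints_top`, Summits-side, `H = ⊤`).

WHAT.
* `xy_mem_fixedField_of_some_mem_fixedGeomPoints`: the coordinates of an `H`-fixed affine point lie in the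
  fixed field `K̄^H` (the Galois action on `E(K̄)` is coordinatewise, `WeierstrassCurve.smul_def`).
* `exists_map_val_eq_of_mem_fixedGeomPoints` / `fixedGeomPoints_le_range_map_val`: every `H`-fixed point is
  the image of an `L`-rational point of `E` for any intermediate field `L ⊇ K̄^H` (Galois descent at `L`;
  Silverman AEC VIII.§1, proof of Prop. 1.2, for a subfield instead of `K`).
* `moduleFinite_fixedGeomPoints_of_fixedField_le`, `addGroup_fg_fixedGeomPoints_of_fixedField_le`: for `K`
  a number field and `L` finite over `K`, `E(K̄)^H` is a finite `ℤ`-module — the Mordell–Weil theorem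
  `module_finite_point_holds` for the number field `L` (`NumberField.of_module_finite`) pushed along
  `E(L) → E(K̄)` and restricted to the subgroup.
* `isOfFinAddOrder_of_mem_fixedGeomPoints_of_forall_exists_pow_smul_eq`: an `H`-fixed point divisible by
  every power of a prime `p` inside `E(K̄)^H` has finite order — the tree's Krull-intersection lemma
  `isOfFinAddOrder_of_forall_exists_pow_smul_eq` (file `KolyvaginShaStructureIndexFormProofs`) at the finite
  `ℤ`-module `E(K̄)^H`.
HONEST FRAMING: bookkeeping around the tree's Mordell–Weil theorem; nothing about any particular curve;
«beyond-print theorem»: no; BSD is not proved by any of this.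

References: [SilvermanAEC2009] VIII.§1 (proof of Prop. 1.2: `E(K̄)^{G_{K̄/L}} = E(L)`), Thm. VIII.6.7
(Mordell–Weil); [AtiyahMacdonald1969] Cor. 10.19–10.20 (Krull's intersection theorem).
-/

set_option autoImplicit false

noncomputable section

open scoped Classical

universe u

namespace WeierstrassCurve

open Field

variable {K : Type u} [Field K] (V : WeierstrassCurve K)

/-! ## §1 Galois descent at an intermediate field -/

/-- **The coordinates of an `H`-fixed affine point of `E(K̄)` lie in the fixed field `K̄^H`** (the action
of `Γ_K` on `E(K̄)` is coordinatewise). [cite: SilvermanAEC2009, VIII.§1 (proof of Prop. 1.2)] -/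
theorem xy_mem_fixedField_of_some_mem_fixedGeomPoints (H : Subgroup (absoluteGaloisGroup K))
    {x y : AlgebraicClosure K} (h : (V.baseChange (AlgebraicClosure K)).toAffine.Nonsingular x y)
    {P : geomPoints V} (hP : P ∈ V.fixedGeomPoints H) (hPxy : P = Affine.Point.some x y h) :
    x ∈ IntermediateField.fixedField (H.map (absoluteGaloisGroup.toAlgEquiv K).toMonoidHom) ∧
      y ∈ IntermediateField.fixedField (H.map (absoluteGaloisGroup.toAlgEquiv K).toMonoidHom) := by
  rw [mem_fixedGeomPoints_iff] at hP
  subst hPxy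
  have key : ∀ σ ∈ H,
      absoluteGaloisGroup.toAlgEquiv K σ x = x ∧ absoluteGaloisGroup.toAlgEquiv K σ y = y := by
    intro σ hσ
    have hσP := hP σ hσ
    change Affine.Point.map ((absoluteGaloisGroup.toAlgEquiv K σ :
        AlgebraicClosure K ≃ₐ[K] AlgebraicClosure K) : AlgebraicClosure K →ₐ[K] AlgebraicClosure K)
        (Affine.Point.some x y h) = Affine.Point.some x y h at hσP
    rw [Affine.Point.map_some] at hσP
    simpa only [Affine.Point.some.injEq, AlgEquiv.coe_toAlgHom, AlgHom.coe_coe] using hσP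
  simp only [IntermediateField.mem_fixedField_iff, Subgroup.mem_map, MulEquiv.coe_toMonoidHom,
    forall_exists_index, and_imp]
  exact ⟨fun f σ hσ hf ↦ hf ▸ (key σ hσ).1, fun f σ hσ hf ↦ hf ▸ (key σ hσ).2⟩

/-- **Galois descent at an intermediate field `L ⊇ K̄^H`**: every `H`-fixed point of `E(K̄)` is the image of
an `L`-rational point of `E` under `E(L) → E(K̄)` (the point with the same coordinates, non-singular over `L`
because `L → K̄` is injective). [cite: SilvermanAEC2009, VIII.§1 (proof of Prop. 1.2)] -/
theorem exists_map_val_eq_of_mem_fixedGeomPoints (H : Subgroup (absoluteGaloisGroup K))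
    (L : IntermediateField K (AlgebraicClosure K))
    (hL : IntermediateField.fixedField (H.map (absoluteGaloisGroup.toAlgEquiv K).toMonoidHom) ≤ L)
    {P : geomPoints V} (hP : P ∈ V.fixedGeomPoints H) :
    ∃ R : (V.baseChange L).toAffine.Point, Affine.Point.map (W' := V) L.val R = P := by
  cases P with
  | zero => exact ⟨0, rfl⟩
  | some x y h =>
    obtain ⟨hx, hy⟩ := V.xy_mem_fixedField_of_some_mem_fixedGeomPoints H h hP rfl
    have h' : (V.baseChange L).toAffine.Nonsingular (⟨x, hL hx⟩ : L) (⟨y, hL hy⟩ : L) :=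
      (V.toAffine.baseChange_nonsingular (f := L.val) L.val.injective _ _).mp h
    exact ⟨Affine.Point.some _ _ h', by rw [Affine.Point.map_some]; rfl⟩

/-- **`E(K̄)^H ≤ image of E(L)`** for `L ⊇ K̄^H`, as additive subgroups of `E(K̄)`.
[cite: SilvermanAEC2009, VIII.§1 (proof of Prop. 1.2)] -/
theorem fixedGeomPoints_le_range_map_val (H : Subgroup (absoluteGaloisGroup K))
    (L : IntermediateField K (AlgebraicClosure K))
    (hL : IntermediateField.fixedField (H.map (absoluteGaloisGroup.toAlgEquiv K).toMonoidHom) ≤ L) :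
    V.fixedGeomPoints H ≤ (Affine.Point.map (W' := V) L.val).range := fun _ hP ↦
  V.exists_map_val_eq_of_mem_fixedGeomPoints H L hL hP

/-! ## §2 Mordell–Weil at the layer -/

/-- **`E(K̄)^H` is a finite `ℤ`-module when `K̄^H ⊆ L` with `L/K` finite** (`K` a number field): the
Mordell–Weil theorem for the number field `L` (`module_finite_point_holds`, `NumberField.of_module_finite`)
pushed forward along `E(L) → E(K̄)` and restricted to the subgroup `E(K̄)^H` (`ℤ` is Noetherian).
[cite: SilvermanAEC2009, Thm. VIII.6.7 and VIII.§1 (proof of Prop. 1.2)] -/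
theorem moduleFinite_fixedGeomPoints_of_fixedField_le [NumberField K] [V.IsElliptic]
    (H : Subgroup (absoluteGaloisGroup K)) (L : IntermediateField K (AlgebraicClosure K))
    [FiniteDimensional K L]
    (hL : IntermediateField.fixedField (H.map (absoluteGaloisGroup.toAlgEquiv K).toMonoidHom) ≤ L) :
    Module.Finite ℤ (V.fixedGeomPoints H) := by
  haveI : NumberField L := NumberField.of_module_finite K L
  -- Mordell–Weil for `E` over the number field `L` (up to the `DecidableEq` instance feeding the group law)
  haveI : Module.Finite ℤ (V.baseChange L).toAffine.Point := by
    convert (V.baseChange L).module_finite_point_holds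
  -- the image of `E(L)` in `E(K̄)` is finitely generated, and `E(K̄)^H` sits inside it
  set f : (V.baseChange L).toAffine.Point →+ geomPoints V := Affine.Point.map (W' := V) L.val with hf
  haveI : Module.Finite ℤ f.range :=
    Module.Finite.of_surjective f.rangeRestrict.toIntLinearMap (by
      intro y
      obtain ⟨x, hx⟩ := y.2
      exact ⟨x, Subtype.ext hx⟩)
  have hle : V.fixedGeomPoints H ≤ f.range := V.fixedGeomPoints_le_range_map_val H L hL
  exact Module.Finite.of_injective (AddSubgroup.inclusion hle).toIntLinearMap
    (AddSubgroup.inclusion_injective hle)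

/-- **`E(K̄)^H` is a finitely generated abelian group** (group form of the previous theorem).
[cite: SilvermanAEC2009, Thm. VIII.6.7] -/
theorem addGroup_fg_fixedGeomPoints_of_fixedField_le [NumberField K] [V.IsElliptic]
    (H : Subgroup (absoluteGaloisGroup K)) (L : IntermediateField K (AlgebraicClosure K))
    [FiniteDimensional K L]
    (hL : IntermediateField.fixedField (H.map (absoluteGaloisGroup.toAlgEquiv K).toMonoidHom) ≤ L) :
    AddGroup.FG (V.fixedGeomPoints H) :=
  (Module.Finite.iff_addGroup_fg).mp (V.moduleFinite_fixedGeomPoints_of_fixedField_le H L hL)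

end WeierstrassCurve

/-! ## §3 Infinitely `p`-divisible fixed points are torsion -/

namespace Literature.NumberTheory.EllipticCurves

open WeierstrassCurve Field

/-- **An `H`-fixed point of `E(K̄)` which is divisible by every power of `p` INSIDE `E(K̄)^H` is a torsion
point**, when `K̄^H ⊆ L` with `L/K` a finite extension of the number field `K` (Mordell–Weil at `L`).
[cite: SilvermanAEC2009, Thm. VIII.6.7] [cite: AtiyahMacdonald1969, Cor. 10.19] -/
theorem isOfFinAddOrder_of_mem_fixedGeomPoints_of_forall_exists_pow_smul_eq {K : Type u} [Field K]
    [NumberField K] (V : WeierstrassCurve K) [V.IsElliptic] (H : Subgroup (absoluteGaloisGroup K))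
    (L : IntermediateField K (AlgebraicClosure K)) [FiniteDimensional K L]
    (hL : IntermediateField.fixedField (H.map (absoluteGaloisGroup.toAlgEquiv K).toMonoidHom) ≤ L)
    {p : ℕ} (hp : p.Prime) {Q : WeierstrassCurve.geomPoints V} (hQ : Q ∈ V.fixedGeomPoints H)
    (hdiv : ∀ m : ℕ, ∃ R ∈ V.fixedGeomPoints H, ((p : ℤ) ^ m) • R = Q) :
    IsOfFinAddOrder Q := by
  haveI := V.moduleFinite_fixedGeomPoints_of_fixedField_le H L hL
  have h : IsOfFinAddOrder (⟨Q, hQ⟩ : V.fixedGeomPoints H) := by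
    refine isOfFinAddOrder_of_forall_exists_pow_smul_eq hp fun m ↦ ?_
    obtain ⟨R, hR, hRQ⟩ := hdiv m
    exact ⟨⟨R, hR⟩, Subtype.ext (by rw [AddSubgroupClass.coe_zsmul, Nat.cast_pow]; exact hRQ)⟩
  obtain ⟨n, hn, hnQ⟩ := h.exists_nsmul_eq_zero
  exact isOfFinAddOrder_iff_nsmul_eq_zero.mpr ⟨n, hn, by
    simpa only [AddSubgroupClass.coe_nsmul, ZeroMemClass.coe_zero] using congrArg Subtype.val hnQ⟩

end Literature.NumberTheory.EllipticCurves

end
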